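/-
Copyright: the b2b-balaban T⁴-continuum CRUX team, row NE7b leaf lineage `t4-ne7b-formalise-leaf-03` (gen 152). Project licence.
-/
import Summits.QuantumFields.BalabanUV.T4Continuum.Spine.NE7b.OneShotChartFibreIdentity

/-!
# FEJÉR CONCENTRATION BY PARSEVAL ALONE: plane-wave packets on a box, their two masses, and the far-mass bound
# (tools for the `≥` direction of the η-ℓ² one-shot chart constant; row NE7b, node U5c; [folklore] — nothing of Bałaban's)

Cell `pub-balaban`, sub-cell `t4`, spine estimate NE7b (`T4WeightBudget.RelWeightBound`; the cell's OWN estimate — NOT PRINTED in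
[Bałaban 1983–89], NOT PROVED).  Crux-route work under `Spine/NE7b/` by leaf-03 (CRUX team (2), FREEZE (0) crux-prover clause, gen 152),
FILING-CLAIM C-leaf03-g152-SHARP (journal [NE7bLEAF03-G152-ONLINE]).  NOTHING of Bałaban's is asserted; no `T4Continuum/Support` leaf; no
`def`; zero `sorry`.  Used BY NAME: this lineage's OSFI `OneShotChartFibreIdentity.tsum_normSq_latticeKernel_eq` (Parseval for lattice kernels),
`B4Green244.latticeKernel_sum_mul` ∕ `latticeKernel_phase` (superposition, pure phases), `B6QGQLower276.chart` ∕ `B` (the box `[0,m+1)^d` as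
`B m 0`), `B4Strip.S1r_ge` (Jordan: `2 − 2cos x ≥ 4x²∕π²` on `|x| ≤ π`), Mathlib's `geom_sum_mul` and `Finset.prod_univ_sum`.

WHY.  The `≥` direction of the chart constant (file `OneShotChartFibreSharp`) needs a family of fields whose transforms concentrate at a
given momentum `p₀`.  The plane-wave packet `c_y = e^{ip₀·y}` on the box `[0,m+1)^d` does it, and EVERYTHING about it that the argument
needs is a PARSEVAL identity or a pointwise telescoping — no Fubini, no shifted periodic integrals: total mass `(2π)^{−d}∫‖ĉ‖² = (m+1)^d`;
multiplying `ĉ` by `e^{iθ_μ} − 1` (`θ = p₀ − p`) telescopes the `μ`-th Dirichlet factor, so `‖ĉ‖²‖e^{iθ_μ} − 1‖² ≤ 4‖ĉ_face‖²` with the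
face `{z_μ = 0}` of `(m+1)^{d−1}` points; and where some coordinate of `p` is `δ`-far from an interior `p₀`, one factor `‖e^{iθ_μ} − 1‖²` is
`≥ 4δ²∕π²`.  Hence the far mass is `≤ (π²∕δ²)·d·(2π)^d(m+1)^{d−1}` against a total of `(2π)^d(m+1)^d`.

WHAT IS PROVED ([folklore]):
* §1 trigonometric polynomials `P ↦ Σ_{y∈T} c_y e^{−iP·y}` (`c : ℤ^d → ℂ`, finite window `T`): `continuous_trigPoly`, **`latticeKernel_trigPoly`**
  (the lattice kernel IS the coefficient sequence), **`trigPoly_parseval`** (`(2π)^{−d}∫‖·‖² = Σ_T‖c_y‖²`), `integrableOn_normSq_trigPoly`.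
* §2 the packet `c_y = e^{ip₀·y}`: `wave_mul_char` ∕ `packet_eq` (`ĉ(p) = Σ_{y∈T} e^{i(p₀−p)·y}`), **`packet_mass`** (`(2π)^{−d}∫‖ĉ‖² = #T`),
  `packet_prod` (separation of variables on a sub-box `Π_μ t_μ`, read through `chart m 0`), `norm_dirichlet_mul_le`
  (`‖Σ_{j≤m}e^{ijθ}‖·‖e^{iθ} − 1‖ ≤ 2`), **`normSq_packet_mul_le`** (the boundary-layer bound), `card_face` (`(m+1)^{d−1}`),
  **`packet_boundary_mass_le`** (`∫‖ĉ‖²‖e^{i(p₀−p)_μ} − 1‖² ≤ 4(2π)^d(m+1)^{d−1}`).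
* §3 `normSq_cexp_sub_one` (`‖e^{iθ} − 1‖² = 2 − 2cos θ`), `S1r_ge_of_far` (`≥ 4δ²∕π²` for `δ ≤ |θ| ≤ 2π − δ`), **`one_le_far_weight`**
  (interior centre `|p₀_μ| ≤ π − ρ`, `0 < δ ≤ ρ`: on the far region `1 ≤ (π²∕(4δ²))Σ_μ‖e^{i(p₀−p)_μ} − 1‖²`).
* §4 `measurableSet_far`, **`packet_far_mass_le`** (`∫_{zone ∩ far}‖ĉ‖² ≤ (π²∕(4δ²))·d·4(2π)^d(m+1)^{d−1}`) and **`packet_near_mass_ge`**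
  (`∫_{zone ∖ far}‖ĉ‖² ≥ (2π)^d(m+1)^d −` the same).

NOT HERE (honest): the one-shot section `H` (files `OneShotChartConcentration`, `OneShotChartFibreSharp`); anything of Bałaban's.  BY-NAME
EFFECT ON THE WALL: NONE.  NE7b NOT PRINTED ∕ NOT PROVED; spine PROVED 0∕9; rung (B)+1 on a FINITE torus — NOT infinite volume, NOT the mass
gap, NOT Clay.  HONEST DEPENDENCY: continuum YM on T⁴ ⇐ BetaPertH ∧ nine spine estimates (0∕9 proved); BetaPertH ⇐ (D1) ∧ (D4) ∧ CAP+tail;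
G-an2-4 gates asym, D1 and NE2∕3∕4.
-/

set_option autoImplicit false

namespace Summit.QuantumFields.BalabanUV.T4Continuum.NE7b.OneShotChartFejer

open Finset Complex MeasureTheory Filter Topology Set
open Literature.MathematicalPhysics.QuantumFieldTheory.Balaban1983to89
open B4Strip (ofRealVec S1r S1r_eq S1r_ge)
open B4ContourShift (BZ latticeKernel integrand)
open B4Green244 (phaseC phaseC_ofRealVec latticeKernel_sum_mul latticeKernel_phase)
open B6QGQLower276 (X B chart chart_inj)
open B6QGQDecay237 (card_B)
open B5Momentum166Zd (isCompact_BZ measurableSet_BZ phaseC_eq)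
open B5Ineq167SymbolZd (phase phase_add phase_e)
open B6QGQFourier275Zd (continuous_cexp_phase sum_B_eq)
open OneShotChartFourier (integrableOn_integrand_of_continuousOn)
open OneShotChartBound (phase_neg)
open OneShotChartFibreIdentity (tsum_normSq_latticeKernel_eq)
open scoped Real

noncomputable section

variable {d : ℕ}

/-! ## §1. Trigonometric polynomials: kernel = coefficients, Parseval -/

/-- a trigonometric polynomial `P ↦ Σ_{y∈T} c_y e^{−iP·y}` is continuous on real momenta. [folklore] -/
theorem continuous_trigPoly (T : Finset (X d)) (c : X d → ℂ) :
    Continuous fun p : Fin d → ℝ => ∑ y ∈ T, c y * cexp (I * phaseC (ofRealVec p) (-y)) := by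
  refine continuous_finsetSum _ fun y _ => continuous_const.mul ?_
  simp_rw [phaseC_ofRealVec]
  exact continuous_cexp_phase (-y)

/-- **the lattice kernel of a trigonometric polynomial is its coefficient sequence**:
`(2π)^{−d}∫ (Σ_{y∈T} c_y e^{−ip·y}) e^{ip·x} dp = c_x` for `x ∈ T`, `0` otherwise. [folklore] -/
theorem latticeKernel_trigPoly (T : Finset (X d)) (c : X d → ℂ) (x : X d) :
    latticeKernel (fun P => ∑ y ∈ T, c y * cexp (I * phaseC P (-y))) x = if x ∈ T then c x else 0 := by
  have hint : ∀ y ∈ T, IntegrableOn (integrand (fun P => cexp (I * phaseC P (-y))) x) (BZ d) := fun y _ =>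
    integrableOn_integrand_of_continuousOn (by
      simp_rw [phaseC_ofRealVec]; exact (continuous_cexp_phase (-y)).continuousOn) x
  rw [latticeKernel_sum_mul T c (fun y P => cexp (I * phaseC P (-y))) x hint]
  simp_rw [latticeKernel_phase]
  have h : ∀ y ∈ T, c y * (if x + -y = 0 then (1 : ℂ) else 0) = if x = y then c x else 0 := by
    intro y _
    by_cases hxy : x = y
    · subst hxy; simp
    · have hne : x + -y ≠ 0 := by rwa [← sub_eq_add_neg, sub_ne_zero]
      simp [hxy, hne]
  rw [Finset.sum_congr rfl h, Finset.sum_ite_eq]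

/-- **PARSEVAL FOR TRIGONOMETRIC POLYNOMIALS**: `(2π)^{−d}∫_{[−π,π]^d} ‖Σ_{y∈T} c_y e^{−ip·y}‖² dp = Σ_{y∈T} ‖c_y‖²`. [folklore] -/
theorem trigPoly_parseval (T : Finset (X d)) (c : X d → ℂ) :
    ((2 * π) ^ d)⁻¹ * ∫ p in BZ d, ‖∑ y ∈ T, c y * cexp (I * phaseC (ofRealVec p) (-y))‖ ^ 2
      = ∑ y ∈ T, ‖c y‖ ^ 2 := by
  rw [← tsum_normSq_latticeKernel_eq (fun P => ∑ y ∈ T, c y * cexp (I * phaseC P (-y)))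
    (continuous_trigPoly T c).continuousOn]
  simp_rw [latticeKernel_trigPoly]
  rw [tsum_eq_sum (s := T) (fun x hx => by simp [hx])]
  exact Finset.sum_congr rfl fun x hx => by simp [hx]

/-- the modulus squared of a trigonometric polynomial is integrable on the zone. [folklore] -/
theorem integrableOn_normSq_trigPoly (T : Finset (X d)) (c : X d → ℂ) :
    IntegrableOn (fun p : Fin d → ℝ => ‖∑ y ∈ T, c y * cexp (I * phaseC (ofRealVec p) (-y))‖ ^ 2) (BZ d) :=
  ((continuous_trigPoly T c).norm.pow 2).continuousOn.integrableOn_compact isCompact_BZ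

/-! ## §2. Plane-wave packets on the box `B m 0 = [0, m+1)^d` centred at `p₀`: coefficients `c_y = e^{ip₀·y}` -/

/-- `‖e^{iφ}‖ = 1`. [folklore] -/
theorem norm_wave (q : Fin d → ℝ) (y : X d) : ‖cexp (I * ((phase q y : ℝ) : ℂ))‖ = 1 := by
  rw [mul_comm, Complex.norm_exp_ofReal_mul_I]

/-- the real phase is linear in the momentum. [folklore] -/
theorem phase_sub_left (p q : Fin d → ℝ) (y : X d) : phase (p - q) y = phase p y - phase q y := by
  unfold phase
  rw [← Finset.sum_sub_distrib]
  exact Finset.sum_congr rfl fun μ _ => by rw [Pi.sub_apply, sub_mul]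

/-- `e^{ip₀·y}·e^{−ip·y} = e^{i(p₀−p)·y}`. [folklore] -/
theorem wave_mul_char (p₀ p : Fin d → ℝ) (y : X d) :
    cexp (I * ((phase p₀ y : ℝ) : ℂ)) * cexp (I * phaseC (ofRealVec p) (-y))
      = cexp (I * ((phase (p₀ - p) y : ℝ) : ℂ)) := by
  rw [phaseC_ofRealVec, phaseC_eq, phase_neg, ← Complex.exp_add, phase_sub_left]
  push_cast
  ring_nf

/-- the packet's transform is a sum of plane waves at the shifted momentum: `ĉ(p) = Σ_{y∈T} e^{i(p₀−p)·y}`. [folklore] -/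
theorem packet_eq (T : Finset (X d)) (p₀ p : Fin d → ℝ) :
    ∑ y ∈ T, cexp (I * ((phase p₀ y : ℝ) : ℂ)) * cexp (I * phaseC (ofRealVec p) (-y))
      = ∑ y ∈ T, cexp (I * ((phase (p₀ - p) y : ℝ) : ℂ)) :=
  Finset.sum_congr rfl fun y _ => wave_mul_char p₀ p y

/-- **TOTAL MASS of the packet on any window**: `(2π)^{−d}∫‖ĉ‖² = #T`. [folklore] -/
theorem packet_mass (T : Finset (X d)) (p₀ : Fin d → ℝ) :
    ((2 * π) ^ d)⁻¹ * ∫ p in BZ d, ‖∑ y ∈ T, cexp (I * ((phase p₀ y : ℝ) : ℂ)) * cexp (I * phaseC (ofRealVec p) (-y))‖ ^ 2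
      = (T.card : ℝ) := by
  rw [trigPoly_parseval]
  simp_rw [norm_wave, one_pow]
  rw [Finset.sum_const, nsmul_eq_mul, mul_one]

/-- the plane wave on a box point factorises over coordinates: `e^{iθ·chart m 0 z} = Π_μ e^{iθ_μ z_μ}`. [folklore] -/
theorem wave_chart (m : ℕ) (θ : Fin d → ℝ) (z : Fin d → Fin (m + 1)) :
    cexp (I * ((phase θ (chart m 0 z) : ℝ) : ℂ)) = ∏ μ, cexp (I * ((θ μ * ((z μ : ℕ) : ℝ) : ℝ) : ℂ)) := by
  rw [← Complex.exp_sum]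
  congr 1
  unfold phase chart
  push_cast
  rw [Finset.mul_sum]
  refine Finset.sum_congr rfl fun μ _ => ?_
  simp

/-- **SEPARATION OF VARIABLES** for a sub-box `Π_μ t_μ ⊆ [0, m+1)^d` (read through `chart m 0`):
`Σ_{z ∈ Π t} e^{iθ·z} = Π_μ Σ_{j ∈ t_μ} e^{iθ_μ j}`. [folklore] -/
theorem packet_prod (m : ℕ) (t : Fin d → Finset (Fin (m + 1))) (θ : Fin d → ℝ) :
    ∑ z ∈ Fintype.piFinset t, cexp (I * ((phase θ (chart m 0 z) : ℝ) : ℂ))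
      = ∏ μ, ∑ j ∈ t μ, cexp (I * ((θ μ * ((j : ℕ) : ℝ) : ℝ) : ℂ)) := by
  rw [Finset.prod_univ_sum]
  exact Finset.sum_congr rfl fun z _ => wave_chart m θ z

/-- the one-dimensional Dirichlet sum telescopes: `(Σ_{j ≤ m} e^{iθj})·(e^{iθ} − 1) = e^{i(m+1)θ} − 1`, hence
`‖Σ_{j≤m} e^{iθj}‖·‖e^{iθ} − 1‖ ≤ 2`. [folklore] -/
theorem norm_dirichlet_mul_le (m : ℕ) (θ : ℝ) :
    ‖∑ j : Fin (m + 1), cexp (I * ((θ * ((j : ℕ) : ℝ) : ℝ) : ℂ))‖ * ‖cexp (I * (θ : ℂ)) - 1‖ ≤ 2 := by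
  have h0 : ∀ j : Fin (m + 1), cexp (I * ((θ * ((j : ℕ) : ℝ) : ℝ) : ℂ)) = (fun k : ℕ => cexp (I * (θ : ℂ)) ^ k) (j : ℕ) := by
    intro j
    simp only []
    rw [← Complex.exp_nat_mul]
    push_cast
    ring_nf
  have h1 : ∑ j : Fin (m + 1), cexp (I * ((θ * ((j : ℕ) : ℝ) : ℝ) : ℂ)) = ∑ j ∈ Finset.range (m + 1), cexp (I * (θ : ℂ)) ^ j := by
    rw [Finset.sum_congr rfl fun j _ => h0 j, Fin.sum_univ_eq_sum_range (fun k : ℕ => cexp (I * (θ : ℂ)) ^ k) (m + 1)]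
  rw [h1, ← norm_mul, geom_sum_mul]
  calc ‖cexp (I * (θ : ℂ)) ^ (m + 1) - 1‖ ≤ ‖cexp (I * (θ : ℂ)) ^ (m + 1)‖ + ‖(1 : ℂ)‖ := norm_sub_le _ _
    _ = 2 := by rw [norm_pow, mul_comm, Complex.norm_exp_ofReal_mul_I, one_pow, norm_one]; norm_num

/-- **THE BOUNDARY-LAYER BOUND**: for the full box and a direction `μ`,
`‖Σ_{z∈[0,m+1)^d} e^{iθ·z}‖²·‖e^{iθ_μ} − 1‖² ≤ 4·‖Σ_{z∈[0,m+1)^d, z_μ = 0} e^{iθ·z}‖²` — multiplying the packet by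
`e^{iθ_μ} − 1` telescopes the `μ`-th Dirichlet factor. [folklore] -/
theorem normSq_packet_mul_le (m : ℕ) (θ : Fin d → ℝ) (μ : Fin d) :
    ‖∑ z : Fin d → Fin (m + 1), cexp (I * ((phase θ (chart m 0 z) : ℝ) : ℂ))‖ ^ 2 * ‖cexp (I * (θ μ : ℂ)) - 1‖ ^ 2
      ≤ 4 * ‖∑ z ∈ Fintype.piFinset (Function.update (fun _ => (Finset.univ : Finset (Fin (m + 1)))) μ {0}),
          cexp (I * ((phase θ (chart m 0 z) : ℝ) : ℂ))‖ ^ 2 := by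
  have hfull : ∑ z : Fin d → Fin (m + 1), cexp (I * ((phase θ (chart m 0 z) : ℝ) : ℂ))
      = ∏ ν, ∑ j : Fin (m + 1), cexp (I * ((θ ν * ((j : ℕ) : ℝ) : ℝ) : ℂ)) := by
    rw [← packet_prod m (fun _ => Finset.univ) θ, Fintype.piFinset_univ]
  have hsub : ∑ z ∈ Fintype.piFinset (Function.update (fun _ => (Finset.univ : Finset (Fin (m + 1)))) μ {0}),
        cexp (I * ((phase θ (chart m 0 z) : ℝ) : ℂ))
      = ∏ ν ∈ Finset.univ.erase μ, ∑ j : Fin (m + 1), cexp (I * ((θ ν * ((j : ℕ) : ℝ) : ℝ) : ℂ)) := by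
    rw [packet_prod m _ θ, ← Finset.mul_prod_erase Finset.univ _ (Finset.mem_univ μ)]
    rw [Function.update_self, Finset.sum_singleton]
    have h0 : cexp (I * ((θ μ * (((0 : Fin (m + 1)) : ℕ) : ℝ) : ℝ) : ℂ)) = 1 := by simp
    rw [h0, one_mul]
    refine Finset.prod_congr rfl fun ν hν => ?_
    rw [Function.update_of_ne (Finset.ne_of_mem_erase hν)]
  rw [hfull, hsub, ← Finset.mul_prod_erase Finset.univ _ (Finset.mem_univ μ), norm_mul, mul_pow]
  set D : ℝ := ‖∏ ν ∈ Finset.univ.erase μ, ∑ j : Fin (m + 1), cexp (I * ((θ ν * ((j : ℕ) : ℝ) : ℝ) : ℂ))‖ ^ 2 with hD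
  have hD0 : 0 ≤ D := by positivity
  have h2 := norm_dirichlet_mul_le m (θ μ)
  have h3 : ‖∑ j : Fin (m + 1), cexp (I * ((θ μ * ((j : ℕ) : ℝ) : ℝ) : ℂ))‖ ^ 2 * ‖cexp (I * (θ μ : ℂ)) - 1‖ ^ 2 ≤ 4 := by
    rw [← mul_pow]
    have h0 : 0 ≤ ‖∑ j : Fin (m + 1), cexp (I * ((θ μ * ((j : ℕ) : ℝ) : ℝ) : ℂ))‖ * ‖cexp (I * (θ μ : ℂ)) - 1‖ := by positivity
    nlinarith
  calc ‖∑ j : Fin (m + 1), cexp (I * ((θ μ * ((j : ℕ) : ℝ) : ℝ) : ℂ))‖ ^ 2 * D * ‖cexp (I * (θ μ : ℂ)) - 1‖ ^ 2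
      = D * (‖∑ j : Fin (m + 1), cexp (I * ((θ μ * ((j : ℕ) : ℝ) : ℝ) : ℂ))‖ ^ 2 * ‖cexp (I * (θ μ : ℂ)) - 1‖ ^ 2) := by ring
    _ ≤ D * 4 := mul_le_mul_of_nonneg_left h3 hD0
    _ = 4 * D := by ring

/-- the face `{z ∈ [0,m+1)^d : z_μ = 0}` has `(m+1)^{d−1}` points. [folklore] -/
theorem card_face (m : ℕ) (μ : Fin d) :
    ((Fintype.piFinset (Function.update (fun _ => (Finset.univ : Finset (Fin (m + 1)))) μ {0})).card : ℝ)
      = ((m : ℝ) + 1) ^ (d - 1) := by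
  rw [Fintype.card_piFinset, ← Finset.mul_prod_erase Finset.univ _ (Finset.mem_univ μ), Function.update_self,
    Finset.card_singleton, one_mul]
  have h : ∀ ν ∈ Finset.univ.erase μ, (Function.update (fun _ => (Finset.univ : Finset (Fin (m + 1)))) μ {0} ν).card = m + 1 :=
    fun ν hν => by rw [Function.update_of_ne (Finset.ne_of_mem_erase hν), Finset.card_univ, Fintype.card_fin]
  rw [Finset.prod_congr rfl h, Finset.prod_const, Finset.card_erase_of_mem (Finset.mem_univ μ), Finset.card_univ,
    Fintype.card_fin]
  push_cast
  ring

/-- **THE `μ`-TH BOUNDARY MASS OF THE PACKET**: `∫_{[−π,π]^d} ‖ĉ(p)‖²·‖e^{i(p₀−p)_μ} − 1‖² dp ≤ 4(2π)^d(m+1)^{d−1}` for the packet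
`c_y = e^{ip₀·y}` on the box `B m 0 = [0,m+1)^d` — by the boundary-layer bound and Parseval on the face. [folklore] -/
theorem packet_boundary_mass_le (m : ℕ) (p₀ : Fin d → ℝ) (μ : Fin d) :
    ∫ p in BZ d, ‖∑ y ∈ B m 0, cexp (I * ((phase p₀ y : ℝ) : ℂ)) * cexp (I * phaseC (ofRealVec p) (-y))‖ ^ 2
        * ‖cexp (I * ((p₀ μ - p μ : ℝ) : ℂ)) - 1‖ ^ 2
      ≤ 4 * (2 * π) ^ d * ((m : ℝ) + 1) ^ (d - 1) := by
  set F : Finset (X d) := (Fintype.piFinset (Function.update (fun _ => (Finset.univ : Finset (Fin (m + 1)))) μ {0})).image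
    (chart m 0) with hF
  have hinj : Function.Injective (chart m (0 : X d)) := fun z z' h => (chart_inj h).2
  -- pointwise: the boundary-layer bound, read on real momenta
  have hpt : ∀ p : Fin d → ℝ,
      ‖∑ y ∈ B m 0, cexp (I * ((phase p₀ y : ℝ) : ℂ)) * cexp (I * phaseC (ofRealVec p) (-y))‖ ^ 2
          * ‖cexp (I * ((p₀ μ - p μ : ℝ) : ℂ)) - 1‖ ^ 2
        ≤ 4 * ‖∑ y ∈ F, cexp (I * ((phase p₀ y : ℝ) : ℂ)) * cexp (I * phaseC (ofRealVec p) (-y))‖ ^ 2 := by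
    intro p
    rw [packet_eq, packet_eq, sum_B_eq, hF, Finset.sum_image fun z _ z' _ h => hinj h]
    have hθ : ((p₀ μ - p μ : ℝ) : ℂ) = (((p₀ - p) μ : ℝ) : ℂ) := by simp
    rw [hθ]
    exact normSq_packet_mul_le m (p₀ - p) μ
  have hFcard : (F.card : ℝ) = ((m : ℝ) + 1) ^ (d - 1) := by
    rw [hF, Finset.card_image_of_injective _ hinj, card_face]
  have hmassF := packet_mass F p₀
  rw [hFcard] at hmassF
  have hpi : (0 : ℝ) < (2 * π) ^ d := by positivity
  have hint : ∫ p in BZ d, ‖∑ y ∈ F, cexp (I * ((phase p₀ y : ℝ) : ℂ)) * cexp (I * phaseC (ofRealVec p) (-y))‖ ^ 2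
      = (2 * π) ^ d * ((m : ℝ) + 1) ^ (d - 1) := by
    rw [← hmassF]; field_simp
  calc ∫ p in BZ d, ‖∑ y ∈ B m 0, cexp (I * ((phase p₀ y : ℝ) : ℂ)) * cexp (I * phaseC (ofRealVec p) (-y))‖ ^ 2
          * ‖cexp (I * ((p₀ μ - p μ : ℝ) : ℂ)) - 1‖ ^ 2
      ≤ ∫ p in BZ d, 4 * ‖∑ y ∈ F, cexp (I * ((phase p₀ y : ℝ) : ℂ)) * cexp (I * phaseC (ofRealVec p) (-y))‖ ^ 2 := by
        refine setIntegral_mono_on ?_ ((integrableOn_normSq_trigPoly F _).const_mul 4) measurableSet_BZ fun p _ => hpt p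
        have hc : Continuous fun p : Fin d → ℝ => ‖cexp (I * ((p₀ μ - p μ : ℝ) : ℂ)) - 1‖ ^ 2 := by fun_prop
        exact ((((continuous_trigPoly (B m 0) _).norm.pow 2).mul hc).continuousOn).integrableOn_compact isCompact_BZ
    _ = 4 * (2 * π) ^ d * ((m : ℝ) + 1) ^ (d - 1) := by rw [integral_const_mul, hint]; ring

/-! ## §3. The far region: where one coordinate is `δ`-far from `p₀`, one of the factors `‖e^{i(p₀−p)_μ} − 1‖²` is `≥ 4δ²∕π²` -/

/-- `‖e^{iθ} − 1‖² = 2 − 2cos θ`. [folklore] -/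
theorem normSq_cexp_sub_one (θ : ℝ) : ‖cexp (I * (θ : ℂ)) - 1‖ ^ 2 = S1r θ := by
  rw [Complex.norm_exp_I_mul_ofReal_sub_one, S1r_eq, Real.norm_eq_abs, sq_abs]
  ring

/-- `2 − 2cos θ ≥ 4δ²∕π²` whenever `δ ≤ |θ| ≤ 2π − δ` (`0 < δ`). [folklore] -/
theorem S1r_ge_of_far {θ δ : ℝ} (hδ : 0 < δ) (h1 : δ ≤ |θ|) (h2 : |θ| ≤ 2 * π - δ) : 4 * δ ^ 2 / π ^ 2 ≤ S1r θ := by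
  have hpi := Real.pi_pos
  have key : ∀ t : ℝ, δ ≤ |t| → |t| ≤ π → 4 * δ ^ 2 / π ^ 2 ≤ S1r t := fun t ht hπ => by
    calc 4 * δ ^ 2 / π ^ 2 ≤ 4 * t ^ 2 / π ^ 2 := by
          rw [← sq_abs t]; gcongr
      _ ≤ S1r t := S1r_ge t hπ
  by_cases hθ : |θ| ≤ π
  · exact key θ h1 hθ
  · push Not at hθ
    -- shift by one period towards zero
    have hper : ∀ t : ℝ, S1r (t - 2 * π) = S1r t := fun t => by unfold S1r; rw [Real.cos_sub_two_pi]
    rcases le_or_gt 0 θ with hθ0 | hθ0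
    · rw [abs_of_nonneg hθ0] at h1 h2 hθ
      rw [← hper θ]
      refine key (θ - 2 * π) ?_ ?_
      · rw [abs_of_nonpos (by linarith)]; linarith
      · rw [abs_of_nonpos (by linarith)]; linarith
    · rw [abs_of_neg hθ0] at h1 h2 hθ
      have hper' : S1r (θ + 2 * π) = S1r θ := by rw [← hper (θ + 2 * π), add_sub_cancel_right]
      rw [← hper']
      refine key (θ + 2 * π) ?_ ?_
      · rw [abs_of_nonneg (by linarith)]; linarith
      · rw [abs_of_nonneg (by linarith)]; linarith

/-- **THE FAR REGION IS SEEN BY ONE FACTOR**: if `|p₀_μ| ≤ π − ρ` for all `μ` (an interior centre), `0 < δ ≤ ρ`, `p ∈ [−π,π]^d` and some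
coordinate of `p` is `δ`-far from `p₀`, then `1 ≤ (π²∕(4δ²))·Σ_μ ‖e^{i(p₀−p)_μ} − 1‖²`. [folklore] -/
theorem one_le_far_weight (p₀ p : Fin d → ℝ) {ρ δ : ℝ} (hδ : 0 < δ) (hδρ : δ ≤ ρ) (hp₀ : ∀ μ, |p₀ μ| ≤ π - ρ)
    (hp : p ∈ BZ d) (hfar : ∃ μ, δ ≤ |p μ - p₀ μ|) :
    1 ≤ π ^ 2 / (4 * δ ^ 2) * ∑ μ, ‖cexp (I * ((p₀ μ - p μ : ℝ) : ℂ)) - 1‖ ^ 2 := by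
  obtain ⟨μ, hμ⟩ := hfar
  have hpi := Real.pi_pos
  have hpμ : |p μ| ≤ π := abs_le.mpr ⟨hp.1 μ, hp.2 μ⟩
  have hθ1 : δ ≤ |p₀ μ - p μ| := by rwa [abs_sub_comm]
  have hθ2 : |p₀ μ - p μ| ≤ 2 * π - δ := by
    calc |p₀ μ - p μ| ≤ |p₀ μ| + |p μ| := abs_sub _ _
      _ ≤ (π - ρ) + π := add_le_add (hp₀ μ) hpμ
      _ ≤ 2 * π - δ := by linarith
  have hS : 4 * δ ^ 2 / π ^ 2 ≤ ‖cexp (I * ((p₀ μ - p μ : ℝ) : ℂ)) - 1‖ ^ 2 := by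
    rw [normSq_cexp_sub_one]; exact S1r_ge_of_far hδ hθ1 hθ2
  have hsum : ‖cexp (I * ((p₀ μ - p μ : ℝ) : ℂ)) - 1‖ ^ 2 ≤ ∑ ν, ‖cexp (I * ((p₀ ν - p ν : ℝ) : ℂ)) - 1‖ ^ 2 :=
    Finset.single_le_sum (f := fun ν => ‖cexp (I * ((p₀ ν - p ν : ℝ) : ℂ)) - 1‖ ^ 2) (fun ν _ => by positivity)
      (Finset.mem_univ μ)
  calc (1 : ℝ) = π ^ 2 / (4 * δ ^ 2) * (4 * δ ^ 2 / π ^ 2) := by field_simp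
    _ ≤ π ^ 2 / (4 * δ ^ 2) * ∑ ν, ‖cexp (I * ((p₀ ν - p ν : ℝ) : ℂ)) - 1‖ ^ 2 :=
        mul_le_mul_of_nonneg_left (hS.trans hsum) (by positivity)

/-! ## §4. The far mass of the packet is `O((m+1)^{d−1})`, the near mass is `(m+1)^d − O((m+1)^{d−1})` -/

/-- the far region `{p : ∃ μ, δ ≤ |p_μ − p₀_μ|}` is measurable (closed). [folklore] -/
theorem measurableSet_far (p₀ : Fin d → ℝ) (δ : ℝ) : MeasurableSet {p : Fin d → ℝ | ∃ μ, δ ≤ |p μ - p₀ μ|} := by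
  have h : {p : Fin d → ℝ | ∃ μ, δ ≤ |p μ - p₀ μ|} = ⋃ μ, {p : Fin d → ℝ | δ ≤ |p μ - p₀ μ|} := by
    ext p; simp
  rw [h]
  refine MeasurableSet.iUnion fun μ => (isClosed_le continuous_const ?_).measurableSet
  fun_prop

/-- **FAR MASS**: for an interior centre (`|p₀_μ| ≤ π − ρ`), `0 < δ ≤ ρ`:
`∫_{[−π,π]^d ∩ far} ‖ĉ‖² ≤ (π²∕(4δ²))·d·4(2π)^d(m+1)^{d−1}`. [folklore] -/
theorem packet_far_mass_le (m : ℕ) (p₀ : Fin d → ℝ) {ρ δ : ℝ} (hδ : 0 < δ) (hδρ : δ ≤ ρ) (hp₀ : ∀ μ, |p₀ μ| ≤ π - ρ) :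
    ∫ p in BZ d ∩ {p | ∃ μ, δ ≤ |p μ - p₀ μ|},
        ‖∑ y ∈ B m 0, cexp (I * ((phase p₀ y : ℝ) : ℂ)) * cexp (I * phaseC (ofRealVec p) (-y))‖ ^ 2
      ≤ π ^ 2 / (4 * δ ^ 2) * (d * (4 * (2 * π) ^ d * ((m : ℝ) + 1) ^ (d - 1))) := by
  set Φ : (Fin d → ℝ) → ℝ := fun p =>
    ‖∑ y ∈ B m 0, cexp (I * ((phase p₀ y : ℝ) : ℂ)) * cexp (I * phaseC (ofRealVec p) (-y))‖ ^ 2 with hΦ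
  set W : (Fin d → ℝ) → ℝ := fun p => ∑ μ, ‖cexp (I * ((p₀ μ - p μ : ℝ) : ℂ)) - 1‖ ^ 2 with hW
  have hΦc : Continuous Φ := (continuous_trigPoly (B m 0) _).norm.pow 2
  have hWc : Continuous W := by simp only [hW]; fun_prop
  have hprod : IntegrableOn (fun p => π ^ 2 / (4 * δ ^ 2) * (Φ p * W p)) (BZ d) :=
    (((hΦc.mul hWc).continuousOn).integrableOn_compact isCompact_BZ).const_mul _
  calc ∫ p in BZ d ∩ {p | ∃ μ, δ ≤ |p μ - p₀ μ|}, Φ p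
      ≤ ∫ p in BZ d ∩ {p | ∃ μ, δ ≤ |p μ - p₀ μ|}, π ^ 2 / (4 * δ ^ 2) * (Φ p * W p) := by
        refine setIntegral_mono_on ((hΦc.continuousOn.integrableOn_compact isCompact_BZ).mono_set Set.inter_subset_left)
          (hprod.mono_set Set.inter_subset_left) (measurableSet_BZ.inter (measurableSet_far p₀ δ)) fun p hp => ?_
        have h1 := one_le_far_weight p₀ p hδ hδρ hp₀ hp.1 hp.2
        have hΦ0 : 0 ≤ Φ p := by positivity
        calc Φ p = Φ p * 1 := (mul_one _).symm
          _ ≤ Φ p * (π ^ 2 / (4 * δ ^ 2) * W p) := mul_le_mul_of_nonneg_left h1 hΦ0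
          _ = π ^ 2 / (4 * δ ^ 2) * (Φ p * W p) := by ring
    _ ≤ ∫ p in BZ d, π ^ 2 / (4 * δ ^ 2) * (Φ p * W p) :=
        setIntegral_mono_set hprod (Eventually.of_forall fun p => by positivity) (Eventually.of_forall Set.inter_subset_left)
    _ = π ^ 2 / (4 * δ ^ 2) * ∑ μ, ∫ p in BZ d, Φ p * ‖cexp (I * ((p₀ μ - p μ : ℝ) : ℂ)) - 1‖ ^ 2 := by
        rw [integral_const_mul]
        congr 1
        simp only [hW, Finset.mul_sum]
        rw [integral_finsetSum]
        intro μ _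
        have hc : Continuous fun p : Fin d → ℝ => ‖cexp (I * ((p₀ μ - p μ : ℝ) : ℂ)) - 1‖ ^ 2 := by fun_prop
        exact ((hΦc.mul hc).continuousOn).integrableOn_compact isCompact_BZ
    _ ≤ π ^ 2 / (4 * δ ^ 2) * ∑ _μ : Fin d, 4 * (2 * π) ^ d * ((m : ℝ) + 1) ^ (d - 1) := by
        gcongr with μ _
        exact packet_boundary_mass_le m p₀ μ
    _ = π ^ 2 / (4 * δ ^ 2) * (d * (4 * (2 * π) ^ d * ((m : ℝ) + 1) ^ (d - 1))) := by
        rw [Finset.sum_const, Finset.card_univ, Fintype.card_fin, nsmul_eq_mul]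

/-- **NEAR MASS**: with the same hypotheses,
`∫_{[−π,π]^d ∖ far} ‖ĉ‖² ≥ (2π)^d(m+1)^d − (π²∕(4δ²))·d·4(2π)^d(m+1)^{d−1}`. [folklore] -/
theorem packet_near_mass_ge (m : ℕ) (p₀ : Fin d → ℝ) {ρ δ : ℝ} (hδ : 0 < δ) (hδρ : δ ≤ ρ) (hp₀ : ∀ μ, |p₀ μ| ≤ π - ρ) :
    (2 * π) ^ d * ((m : ℝ) + 1) ^ d - π ^ 2 / (4 * δ ^ 2) * (d * (4 * (2 * π) ^ d * ((m : ℝ) + 1) ^ (d - 1)))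
      ≤ ∫ p in BZ d \ {p | ∃ μ, δ ≤ |p μ - p₀ μ|},
        ‖∑ y ∈ B m 0, cexp (I * ((phase p₀ y : ℝ) : ℂ)) * cexp (I * phaseC (ofRealVec p) (-y))‖ ^ 2 := by
  have hI := integrableOn_normSq_trigPoly (B m 0) (fun y => cexp (I * ((phase p₀ y : ℝ) : ℂ)))
  have hsplit := integral_inter_add_sdiff (measurableSet_far p₀ δ) hI
  have htot : ∫ p in BZ d, ‖∑ y ∈ B m 0, cexp (I * ((phase p₀ y : ℝ) : ℂ)) * cexp (I * phaseC (ofRealVec p) (-y))‖ ^ 2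
      = (2 * π) ^ d * ((m : ℝ) + 1) ^ d := by
    have h := packet_mass (B m 0) p₀
    rw [card_B] at h
    have hpi : (0 : ℝ) < (2 * π) ^ d := by positivity
    rw [← h]; field_simp
  have hfar := packet_far_mass_le m p₀ hδ hδρ hp₀
  rw [htot] at hsplit
  linarith

end

end Summit.QuantumFields.BalabanUV.T4Continuum.NE7b.OneShotChartFejer
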